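import Mathlib
import HarnessLib
import Literature.MathematicalPhysics.StatisticalMechanics.PolymerProductABKM
import Literature.MathematicalPhysics.StatisticalMechanics.PolymerProductLipschitz
import Literature.MathematicalPhysics.StatisticalMechanics.PolymerFactorisationDifference
import Literature.MathematicalPhysics.StatisticalMechanics.StrongNormExpLipschitz

/-!
# Lemma 9.4 of [ABKM19] (map `P₂ = (e^{−H} − 1) ∘ K`) for the concrete torus data, LIPSCHITZ form:
# `|P₂(e^{−H},K)(X) − P₂(e^{−H'},K')(X)|_{k,X,T_φ} ≤ Σ_{Y ⊆ X} [ ((a'+δ)^{𝓑(X∖Y)} − a'^{𝓑(X∖Y)}) ∏_{Z ∈ 𝒞(Y)} C A^{−|Z|_k}`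
# `  + a'^{𝓑(X∖Y)} (∏_{Z ∈ 𝒞(Y)} (C + C_Δ) A^{−|Z|_k} − ∏_{Z} C A^{−|Z|_k}) ] · w_k^X(φ)`

with `a' = 8e^{1/4}‖H'‖_{k,0}`, `δ = 16e^{3/8}‖H − H'‖_{k,0}` (products over the `k`-blocks of `X ∖ Y`),
for `‖H‖_{k,0}, ‖H'‖_{k,0} ≤ 1/16`, activities `K, K'` factorising on scale `k` with `K(∅) = K'(∅) = 1`,
`C^{r₀}`, local, `‖K‖_k^{(A)}, ‖K'‖_k^{(A)} ≤ C` and `‖K − K'‖_k^{(A)} ≤ C_Δ`.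

This is the P₂-LIPSCHITZ ASSEMBLY on `X₂` of the crux line `gnv` (`Summits/HubbardSuperconductivity`,
crux `HypACumulant`, stub `stub_gnvOfFrd`; memo CH12-PLAN §5 (a)): the abstract first-order brick
`PolymerProductLipschitz.tayNormLE_sum_bprod_mul_sub` instantiated with the strong weight `W_k^B`
(`StrongWeightABKM`), the Lipschitz bound of `E` (`StrongNormExpLipschitz.tayNormLE_expNegH_sub_strong_abkm`,
Lemma 9.3), the zeroth-order bound `‖e^{−H'(B)} − 1‖ ≤ 8e^{1/4}‖H'‖` (`tayNormLE_expNegH_sub_one_strong_abkm`),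
Lemma 8.3 (i) for `K` (`tayNormLE_of_factorises`) and for `K − K'` (`tayNormLE_factorises_sub`), and the
weight inequality (w5) (`weight_mul_prod_strongWeight_le`) — exactly as `PolymerProductABKM.tayNormLE_P2_abkm`
assembles the zeroth order.

* `isGaugeLocal_of_factorises_polys` — a factorising activity local on connected polymers is local on
  every polymer (for the polymer's gauge);
* **`tayNormLE_P2_sub_abkm`** — the displayed bound.

Everything is proved; no named fact.

## References
* S. Adams, S. Buchholz, R. Kotecký, S. Müller, arXiv:1910.13564, Lemma 9.4 ((9.18)–(9.21)), Lemma 9.3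
  (9.13), Lemma 8.3, Theorem 7.1 (w3), (w5) [AdamsBuchholzKoteckyMuller2019].
-/

noncomputable section

namespace Literature.MathematicalPhysics.StatisticalMechanics.GradientRG

open scoped BigOperators Classical
open Finset Matrix
open Literature.MathematicalPhysics.StatisticalMechanics.TorusPolymer
  (IsPolymer Separated blocks polys bprod blockOf thicken mem_polys mem_blocks isPolymer_blockOf
    isPolymer_empty)
open Literature.Barriers.CriticalPhenomena.LongRangePhi4.Polymer (IsConn components)
open Literature.MathematicalPhysics.QuantumFieldTheory

variable {d M : ℕ} [NeZero M]

/-- **A factorising activity that is local on connected polymers is local on every polymer**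
(`K(Y) = ∏_{Z ∈ 𝒞(Y)} K(Z)`, each factor local for the smaller gauge of `Z ⊆ Y`); odd torus
`M = s·t`. [cite: AdamsBuchholzKoteckyMuller2019, Lemma 8.3 (i) (proof)] -/
theorem isGaugeLocal_of_factorises_polys {s t : ℕ} (hMt : M = s * t) (hs : Odd s) (ht : Odd t)
    {𝔥 Rg : ℝ} {p rad : ℕ} {K : Finset (Fin d → ZMod M) → ((Fin d → ZMod M) → ℝ) → ℂ}
    (hKfac : Factorises s K) (hK0 : ∀ φ, K ∅ φ = 1)
    (hKloc : ∀ Y, IsPolymer s Y → IsConn Y → IsGaugeLocal (fieldGauge 𝔥 Rg p (thicken rad Y)) (K Y))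
    {Y : Finset (Fin d → ZMod M)} (hY : IsPolymer s Y) :
    IsGaugeLocal (fieldGauge 𝔥 Rg p (thicken rad Y)) (K Y) := by
  have hMo : Odd M := by rw [hMt]; exact hs.mul ht
  have hpoly : ∀ Z ∈ components Y, IsPolymer s Z := fun Z hZ =>
    (TorusPolymer.IsPolymer.of_mem_components hMo hs hY hZ).1
  have hsep := TorusPolymer.pairwise_separated_components hMt hs ht hY
  have hKeq : K Y = fun φ => ∏ Z ∈ components Y, K Z φ := by
    funext φ
    conv_lhs => rw [Literature.Barriers.CriticalPhenomena.LongRangePhi4.Polymer.eq_biUnion_components Y]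
    exact eq_prod_of_factorises hKfac hK0 _ hpoly hsep φ
  rw [hKeq]
  refine IsGaugeLocal.prod _ fun Z hZ => ?_
  obtain ⟨hZp, hZc⟩ := TorusPolymer.IsPolymer.of_mem_components hMo hs hY hZ
  have hZY : Z ⊆ Y := by
    rw [Literature.Barriers.CriticalPhenomena.LongRangePhi4.Polymer.eq_biUnion_components Y]
    exact Finset.subset_biUnion_of_mem id hZ
  exact (hKloc Z hZp hZc).of_norm_le fun ξ => norm_fieldGauge_mono_set _ _ _ (TorusPolymer.thicken_mono _ hZY) ξ

/-- **[ABKM19] Lemma 9.4 (first order / Lipschitz) for the torus data.**  Let `P = abkmNormParams …`,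
the weight tower satisfy `AbkmWeightBounds` (`h² ≥ h₀²`, `δ₀, δ₁ > 0`), `d ≥ 2`, `L` odd, `M = L^N`,
`k + 1 ≤ N`, `⌊d/2⌋+1 ≤ p`, `⌊d/2⌋+1 ≤ M_ord`, `A > 0`; let `X` be a `k`-polymer,
`‖H‖_{k,0}, ‖H'‖_{k,0} ≤ 1/16` (at `(𝔥_k, L^k, L^{dk})`), and let `K, K'` factorise on scale `k` with
`K(∅) = K'(∅) = 1`, be `C^{r₀}` and local on connected `k`-polymers with `‖K‖_k^{(A)}, ‖K'‖_k^{(A)} ≤ C`,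
`‖K − K'‖_k^{(A)} ≤ C_Δ` (`C, C_Δ ≥ 0`).  Then, with `a' = 8e^{1/4}‖H'‖_{k,0}` and
`δ = 16e^{3/8}‖H − H'‖_{k,0}`,
`|Σ_{Y ∈ 𝓟_k(X)} (e^{−H}−1)^{X∖Y} K(Y) − Σ_Y (e^{−H'}−1)^{X∖Y} K'(Y)|_{T_X, w_k^X}
  ≤ Σ_Y [ (∏_{B ∈ 𝓑(X∖Y)} (a'+δ) − ∏_B a') ∏_{Z ∈ 𝒞(Y)} C A^{−|Z|_k}
        + (∏_B a') (∏_{Z ∈ 𝒞(Y)} (C A^{−|Z|_k} + C_Δ A^{−|Z|_k}) − ∏_Z C A^{−|Z|_k}) ]`.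
[cite: AdamsBuchholzKoteckyMuller2019, Lemma 9.4 ((9.18)–(9.21), first order)] -/
theorem tayNormLE_P2_sub_abkm {L N Mord R n p r₀ : ℕ} {θbar lam μ δ₁ δ₀ A𝒫 h A : ℝ}
    {𝒞 : ℕ → (Fin d → ZMod M) → ℝ} (hd : 2 ≤ d) (hLodd : Odd L)
    (hM : M = L ^ N) {k : ℕ} (hkN : k + 1 ≤ N) (hp : d / 2 + 1 ≤ p) (hMord : d / 2 + 1 ≤ Mord)
    (hB : AbkmWeightBounds L N Mord R n θbar lam μ δ₁ δ₀ A𝒫 𝒞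
      (abkmWeightData L N Mord R θbar (schedDelta δ₀ δ₁ N) 𝒞))
    (hδ₀ : 0 < δ₀) (hδ₁ : 0 < δ₁) (hh : 0 < h) (hh0 : hZeroSq d R δ₀ δ₁ ≤ h ^ 2) (hA : 0 < A)
    {X : Finset (Fin d → ZMod M)} (hX : IsPolymer (L ^ k) X)
    {H H' : RelevantHamiltonian ℂ d}
    (hH : hamNorm (fieldWt h (L : ℝ) d k) ((L : ℝ) ^ k) (L ^ (d * k)) H ≤ 1 / 16)
    (hH' : hamNorm (fieldWt h (L : ℝ) d k) ((L : ℝ) ^ k) (L ^ (d * k)) H' ≤ 1 / 16)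
    {K K' : Finset (Fin d → ZMod M) → ((Fin d → ZMod M) → ℝ) → ℂ} {C CΔ : ℝ} (hC : 0 ≤ C) (hCΔ : 0 ≤ CΔ)
    (hK : WeakNormLE (abkmNormParams L N Mord R p r₀ h θbar A (schedDelta δ₀ δ₁ N) 𝒞) k K C)
    (hK' : WeakNormLE (abkmNormParams L N Mord R p r₀ h θbar A (schedDelta δ₀ δ₁ N) 𝒞) k K' C)
    (hΔ : WeakNormLE (abkmNormParams L N Mord R p r₀ h θbar A (schedDelta δ₀ δ₁ N) 𝒞) k (K - K') CΔ)
    (hKfac : Factorises (L ^ k) K) (hK0 : ∀ φ, K ∅ φ = 1) (hKd : ∀ Y, ContDiff ℝ r₀ (K Y))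
    (hK'fac : Factorises (L ^ k) K') (hK'0 : ∀ φ, K' ∅ φ = 1) (hK'd : ∀ Y, ContDiff ℝ r₀ (K' Y))
    (hKloc : ∀ Y, IsPolymer (L ^ k) Y → IsConn Y →
      IsGaugeLocal ((abkmNormParams L N Mord R p r₀ h θbar A (schedDelta δ₀ δ₁ N) 𝒞).gauge k Y) (K Y))
    (hK'loc : ∀ Y, IsPolymer (L ^ k) Y → IsConn Y →
      IsGaugeLocal ((abkmNormParams L N Mord R p r₀ h θbar A (schedDelta δ₀ δ₁ N) 𝒞).gauge k Y) (K' Y)) :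
    TayNormLE ((abkmNormParams L N Mord R p r₀ h θbar A (schedDelta δ₀ δ₁ N) 𝒞).gauge k X) r₀
      ((abkmWeightData L N Mord R θbar (schedDelta δ₀ δ₁ N) 𝒞).weight k X)
      (fun φ => ∑ Y ∈ polys (L ^ k) X, bprod (L ^ k) (fun B => expNegH H B φ - 1) (X \ Y) * K Y φ -
        ∑ Y ∈ polys (L ^ k) X, bprod (L ^ k) (fun B => expNegH H' B φ - 1) (X \ Y) * K' Y φ)
      (∑ Y ∈ polys (L ^ k) X,
        (((∏ _B ∈ blocks (L ^ k) (X \ Y),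
            (8 * Real.exp (1 / 4) * hamNorm (fieldWt h (L : ℝ) d k) ((L : ℝ) ^ k) (L ^ (d * k)) H' +
              16 * Real.exp (3 / 8) * hamNorm (fieldWt h (L : ℝ) d k) ((L : ℝ) ^ k) (L ^ (d * k)) (H - H'))) -
          ∏ _B ∈ blocks (L ^ k) (X \ Y),
            8 * Real.exp (1 / 4) * hamNorm (fieldWt h (L : ℝ) d k) ((L : ℝ) ^ k) (L ^ (d * k)) H') *
          ∏ Z ∈ components Y, C * (abkmNormParams L N Mord R p r₀ h θbar A (schedDelta δ₀ δ₁ N) 𝒞).aFactor k Z +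
        (∏ _B ∈ blocks (L ^ k) (X \ Y),
            8 * Real.exp (1 / 4) * hamNorm (fieldWt h (L : ℝ) d k) ((L : ℝ) ^ k) (L ^ (d * k)) H') *
          ((∏ Z ∈ components Y,
              (C * (abkmNormParams L N Mord R p r₀ h θbar A (schedDelta δ₀ δ₁ N) 𝒞).aFactor k Z +
                CΔ * (abkmNormParams L N Mord R p r₀ h θbar A (schedDelta δ₀ δ₁ N) 𝒞).aFactor k Z)) -
            ∏ Z ∈ components Y, C * (abkmNormParams L N Mord R p r₀ h θbar A (schedDelta δ₀ δ₁ N) 𝒞).aFactor k Z))) := by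
  set P := abkmNormParams L N Mord R p r₀ h θbar A (schedDelta δ₀ δ₁ N) 𝒞 with hP
  set W := abkmWeightData L N Mord R θbar (schedDelta δ₀ δ₁ N) 𝒞 with hW
  set s := L ^ k with hs
  have hkN' : k ≤ N := by omega
  have hL0 : (0 : ℝ) < L := by exact_mod_cast hLodd.pos
  obtain ⟨t, ht⟩ : ∃ t, N = k + t := ⟨N - k, by omega⟩
  have hMt : M = s * L ^ t := by rw [hs, ← pow_add, ← ht]; exact hM
  have htodd : Odd (L ^ t) := hLodd.pow
  have hsodd : Odd s := hLodd.pow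
  have hMo : Odd M := by rw [hM]; exact hLodd.pow
  have h𝔥 : 0 < P.𝔥 k := fieldWt_pos hh hL0 d k
  have hR : 0 < P.R k := by show (0 : ℝ) < (L : ℝ) ^ k; positivity
  -- names for the block constants
  set a' : ℝ := 8 * Real.exp (1 / 4) * hamNorm (fieldWt h (L : ℝ) d k) ((L : ℝ) ^ k) (L ^ (d * k)) H'
    with ha'
  set δ : ℝ := 16 * Real.exp (3 / 8) * hamNorm (fieldWt h (L : ℝ) d k) ((L : ℝ) ^ k) (L ^ (d * k)) (H - H')
    with hδdef
  -- strong family and (w5)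
  set G : ℕ → Finset (Fin d → ZMod M) → Matrix (Fin d → ZMod M) (Fin d → ZMod M) ℝ :=
    fun j Y => strongCoef h N j • derivForm (L : ℝ) j (diffIndex d Mord)
      (boxDensity (boxRad R L j) (boxWt (L : ℝ) d j) Y) with hG
  have hGs : W.StrongDominated G fun _ X Y => Disjoint X Y :=
    hB.strong (diffIndex d Mord) (fun α hα => hα) (strongCoef h N) (strongCoef_le hδ₀ hδ₁ hh hh0)
  -- gauges of blocks / sub-polymers are dominated by the gauge of `X`
  have hgauge : ∀ Y ⊆ X, ∀ ξ, ‖P.gauge k Y ξ‖ ≤ ‖P.gauge k X ξ‖ := fun Y hY ξ =>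
    norm_fieldGauge_mono_set _ _ _ (TorusPolymer.thicken_mono _ hY) ξ
  have hcard : ∀ x, (blockOf s x).card = L ^ (d * k) := fun x => by
    rw [TorusPolymer.card_blockOf hMt hsodd htodd x, hs, ← pow_mul, mul_comm]
  have hnn : ∀ H₀ : RelevantHamiltonian ℂ d,
      0 ≤ hamNorm (fieldWt h (L : ℝ) d k) ((L : ℝ) ^ k) (L ^ (d * k)) H₀ := fun H₀ =>
    hamNorm_nonneg (fieldWt_pos hh hL0 d k).le (by positivity : (0 : ℝ) ≤ (L : ℝ) ^ k) (L ^ (d * k)) H₀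
  -- the block functionals `F = e^{−H} − 1`, `F' = e^{−H'} − 1`
  have hF' : ∀ B ∈ blocks s X, TayNormLE (P.gauge k B) r₀ (expWeight (G k B))
      (fun ψ => expNegH H' B ψ - 1) a' := by
    intro B hBm
    obtain ⟨x, -, rfl⟩ := mem_blocks.1 hBm
    have hH'' : hamNorm (fieldWt h (L : ℝ) d k) ((L : ℝ) ^ k) (blockOf s x).card H' ≤ 1 / 8 := by
      rw [hcard x]; linarith
    have := tayNormLE_expNegH_sub_one_strong_abkm (R := R) (N := N) (Mord := Mord) hd hLodd hM hkN' hh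
      hMord hp (TorusPolymer.subset_thicken (P.rad k) (blockOf s x)) r₀ hH''
    rw [hcard x] at this
    exact this
  have hΔF : ∀ B ∈ blocks s X, TayNormLE (P.gauge k B) r₀ (expWeight (G k B))
      (fun ψ => (expNegH H B ψ - 1) - (expNegH H' B ψ - 1)) δ := by
    intro B hBm
    obtain ⟨x, -, rfl⟩ := mem_blocks.1 hBm
    have h1 : hamNorm (fieldWt h (L : ℝ) d k) ((L : ℝ) ^ k) (blockOf s x).card H ≤ 1 / 16 := by
      rw [hcard x]; exact hH
    have h2 : hamNorm (fieldWt h (L : ℝ) d k) ((L : ℝ) ^ k) (blockOf s x).card H' ≤ 1 / 16 := by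
      rw [hcard x]; exact hH'
    have := tayNormLE_expNegH_sub_strong_abkm (R := R) (N := N) (Mord := Mord) hd hLodd hM hkN' hh
      hMord hp (TorusPolymer.subset_thicken (P.rad k) (blockOf s x)) r₀ h1 h2
    rw [hcard x] at this
    have hfun : (fun ψ : (Fin d → ZMod M) → ℝ => (expNegH H (blockOf s x) ψ - 1) - (expNegH H' (blockOf s x) ψ - 1)) =
        fun ψ => expNegH H (blockOf s x) ψ - expNegH H' (blockOf s x) ψ := by
      funext ψ; ring
    rw [hfun]
    exact this
  have hFd : ∀ (H₀ : RelevantHamiltonian ℂ d), ∀ B ∈ blocks s X,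
      ContDiff ℝ r₀ (fun ψ : (Fin d → ZMod M) → ℝ => expNegH H₀ B ψ - 1) :=
    fun H₀ B _ => ((contDiff_eval H₀ B (n := r₀)).neg.cexp).sub contDiff_const
  have hFloc : ∀ (H₀ : RelevantHamiltonian ℂ d), ∀ B ∈ blocks s X, IsGaugeLocal (P.gauge k B)
      (fun ψ : (Fin d → ZMod M) → ℝ => expNegH H₀ B ψ - 1) := fun H₀ B _ =>
    IsGaugeLocal.op₁ _ (fun z : ℂ => z - 1) (isGaugeLocal_cexp_neg_eval h𝔥.ne' hR.ne' hp
      (TorusPolymer.subset_thicken _ _) H₀)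
  have hleb : ∀ B ∈ blocks s X, ∀ ξ, ‖P.gauge k B ξ‖ ≤ ‖P.gauge k X ξ‖ := fun B hBm =>
    hgauge B (hX.subset_of_mem_blocks hBm)
  have ha : ∀ B ∈ blocks s X, (0 : ℝ) ≤ a' := fun _ _ => by
    have := hnn H'; rw [ha']; positivity
  have hδ : ∀ B ∈ blocks s X, (0 : ℝ) ≤ δ := fun _ _ => by
    have := hnn (H - H'); rw [hδdef]; positivity
  -- the activities on the sub-polymers `Y ⊆ X`: Lemma 8.3 (i) for `K` and for `K − K'`
  have hwU : ∀ X' Y', IsPolymer s X' → IsPolymer s Y' → Separated (s + 1) X' Y' →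
      ∀ φ, W.weight k (X' ∪ Y') φ = W.weight k X' φ * W.weight k Y' φ := fun X' Y' _ _ hsep φ =>
    WeightData.weight_union hB.dominated hB.isLocal hB.additive (k := k) hsep φ
  have hw0 : ∀ φ, W.weight k ∅ φ = 1 := weight_empty_of_union hwU (fun φ => W.weight_pos k ∅ φ)
  have hsubZ : ∀ {Y Z : Finset (Fin d → ZMod M)}, Z ∈ components Y → Z ⊆ Y := fun {Y Z} hZ => by
    rw [Literature.Barriers.CriticalPhenomena.LongRangePhi4.Polymer.eq_biUnion_components Y]
    exact Finset.subset_biUnion_of_mem id hZ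
  have hKY : ∀ Y ∈ polys s X, TayNormLE (P.gauge k Y) r₀ (W.weight k Y) (K Y)
      (∏ Z ∈ components Y, C * P.aFactor k Z) := by
    intro Y hY
    obtain ⟨hYX, hYp⟩ := mem_polys.1 hY
    refine tayNormLE_of_factorises hMt hsodd htodd (P.gauge k Y) (fun Z => P.gauge k Z) hwU hw0 hKfac hK0 hYp
      (fun Z hZ => ?_) (fun Z hZ ξ => ?_) (fun Z _ => hKd Z) (fun Z hZ => ?_) (fun Z _ => ?_)
    · obtain ⟨hZp, hZc⟩ := TorusPolymer.IsPolymer.of_mem_components hMo hsodd hYp hZ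
      exact hK Z hZp hZc
    · exact norm_fieldGauge_mono_set _ _ _ (TorusPolymer.thicken_mono _ (hsubZ hZ)) ξ
    · obtain ⟨hZp, hZc⟩ := TorusPolymer.IsPolymer.of_mem_components hMo hsodd hYp hZ
      exact hKloc Z hZp hZc
    · exact mul_nonneg hC (WeakNormLE.aFactor_pos hA k Z).le
  have hΔKY : ∀ Y ∈ polys s X, TayNormLE (P.gauge k Y) r₀ (W.weight k Y) (fun φ => K Y φ - K' Y φ)
      ((∏ Z ∈ components Y, (C * P.aFactor k Z + CΔ * P.aFactor k Z)) -
        ∏ Z ∈ components Y, C * P.aFactor k Z) := by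
    intro Y hY
    obtain ⟨hYX, hYp⟩ := mem_polys.1 hY
    refine tayNormLE_factorises_sub hMt hsodd htodd (P.gauge k Y) (fun Z => P.gauge k Z) hwU hw0
      hKfac hK0 hK'fac hK'0 hYp (fun Z hZ => ?_) (fun Z hZ => ?_) (fun Z hZ ξ => ?_) (fun Z _ => hKd Z)
      (fun Z _ => hK'd Z) (fun Z hZ => ?_) (fun Z hZ => ?_) (fun Z _ => ?_) (fun Z _ => ?_)
    · obtain ⟨hZp, hZc⟩ := TorusPolymer.IsPolymer.of_mem_components hMo hsodd hYp hZ
      exact hK' Z hZp hZc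
    · obtain ⟨hZp, hZc⟩ := TorusPolymer.IsPolymer.of_mem_components hMo hsodd hYp hZ
      exact hΔ Z hZp hZc
    · exact norm_fieldGauge_mono_set _ _ _ (TorusPolymer.thicken_mono _ (hsubZ hZ)) ξ
    · obtain ⟨hZp, hZc⟩ := TorusPolymer.IsPolymer.of_mem_components hMo hsodd hYp hZ
      exact hKloc Z hZp hZc
    · obtain ⟨hZp, hZc⟩ := TorusPolymer.IsPolymer.of_mem_components hMo hsodd hYp hZ
      exact hK'loc Z hZp hZc
    · exact mul_nonneg hC (WeakNormLE.aFactor_pos hA k Z).le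
    · exact mul_nonneg hCΔ (WeakNormLE.aFactor_pos hA k Z).le
  have hlep : ∀ Y ∈ polys s X, ∀ ξ, ‖P.gauge k Y ξ‖ ≤ ‖P.gauge k X ξ‖ := fun Y hY =>
    hgauge Y (mem_polys.1 hY).1
  have hKlocY : ∀ Y ∈ polys s X, IsGaugeLocal (P.gauge k Y) (K Y) := fun Y hY =>
    isGaugeLocal_of_factorises_polys hMt hsodd htodd hKfac hK0 hKloc (mem_polys.1 hY).2
  have hK'locY : ∀ Y ∈ polys s X, IsGaugeLocal (P.gauge k Y) (K' Y) := fun Y hY =>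
    isGaugeLocal_of_factorises_polys hMt hsodd htodd hK'fac hK'0 hK'loc (mem_polys.1 hY).2
  have hc : ∀ Y ∈ polys s X, (0 : ℝ) ≤ ∏ Z ∈ components Y, C * P.aFactor k Z := fun Y _ =>
    Finset.prod_nonneg fun Z _ => mul_nonneg hC (WeakNormLE.aFactor_pos hA k Z).le
  have hρ : ∀ Y ∈ polys s X, (0 : ℝ) ≤ (∏ Z ∈ components Y, (C * P.aFactor k Z + CΔ * P.aFactor k Z)) -
      ∏ Z ∈ components Y, C * P.aFactor k Z := fun Y _ =>
    sub_nonneg.2 (prod_le_prod (fun Z _ => mul_nonneg hC (WeakNormLE.aFactor_pos hA k Z).le)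
      fun Z _ => le_add_of_nonneg_right (mul_nonneg hCΔ (WeakNormLE.aFactor_pos hA k Z).le))
  have hw : ∀ Y ∈ polys s X, ∀ φ, (∏ B ∈ blocks s (X \ Y), expWeight (G k B) φ) * W.weight k Y φ ≤
      W.weight k X φ := fun Y hY φ =>
    weight_mul_prod_strongWeight_le hB.dominated hB.monotone hGs k s hX (mem_polys.1 hY).2 (mem_polys.1 hY).1 φ
  exact tayNormLE_sum_bprod_mul_sub s (P.gauge k X) (fun B => P.gauge k B) (fun Y => P.gauge k Y) hX
    hF' hΔF hleb (hFd H) (hFd H') (hFloc H) (hFloc H') ha hδ hKY hΔKY hlep (fun Y _ => hKd Y)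
    (fun Y _ => hK'd Y) hKlocY hK'locY hc hρ hw

end Literature.MathematicalPhysics.StatisticalMechanics.GradientRG

end
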